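import Summits.BirchSwinnertonDyer.BirchSwinnertonDyer.Theorems.AdditiveBranchIMCGordTwoRankOneHeegnerKolyvaginGss2RecordsTam
import Summits.BirchSwinnertonDyer.BirchSwinnertonDyer.Theorems.KolyvaginDepthDoorDepthTableRowKit
import HarnessLib

/-!
# Route `AdditiveBranchIMC` (rung K1), crux `GordTwoRankOne` (item 19358) — the Heegner–Kolyvagin road, Part 24f:
# the Heegner FIELD of the seven GSS2 kernel records CONSTRUCTED and its Heegner HYPOTHESIS DECIDED in the kernel —
# records with the binders `K`, `hK`, `hdK`, `hHN` (and `htam`, Part 24e) REMOVED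
# (cell `bsd-addord`, second prover lane `bsd-addord-k1-c3x`, gen 9; `--supports` only)

HONEST FRAMING. THEOREMS ONLY (no definition, no named fact, no `sorry`); PER PAIR — NOT a class theorem; nothing is booked by this
file; crux 19358 stays OPEN at class level; BSD is not proved by any of this. Parts 24a–e (`…Gss2Records{A,B,C,D,Tam}`) left the
Heegner field of each row as DISPLAYED data: `(K) (hK : IsImaginaryQuadratic K) (hdK : d_K = d) (hHN : every prime of N_E splits in K)`.
Both are decidable from the integer model and the tree already holds the tools (bsd-jet's depth-table ROW KIT
`KolyvaginDepthDoorDepthTableRowKit`, consumed BY NAME): `KolyvaginDepthDoor.exists_isImaginaryQuadratic_discr_eq` (an imaginary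
quadratic field of prescribed fundamental discriminant EXISTS — Marcus Ch. 2 Thm. 1, tree `Quadratic.exists_numberField_discr_eq`) and
`KolyvaginDepthDoor.satisfiesHeegnerHypothesis_conductorNorm_of_intModel` (the Heegner hypothesis for `N_E` from the Kronecker symbols
`(d/q) = 1` at the primes `q ∣ Δ(E₀)` — decomposition law, tree `satisfiesHeegnerHypothesis_iff_kronecker`; `q ∣ N_E ⇒ q ∣ Δ_min`).
This file adds the list bookkeeping lemma `forall_prime_dvd_of_natAbs_eq_prod` (the primes of `Δ` from a kernel-checked complete
factorisation) and, per row (this file: 182853c1 228897c1 250065g1 355338h1; Part 24g `…Gss2RecordsFieldB`: 409248cy1 439794p1 205128l1), `heegner_g<label>` (the Heegner hypothesis for `(N_E, K)` for EVERY imaginary quadratic `K` with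
`d_K = d`: Jacobi symbols by `norm_num`, `d ≡ 1 (mod 8)` at `q = 2`), `exists_field_g<label>` (such a `K` exists: `d` is a negative
fundamental discriminant, squarefreeness by `decide`), and the record **`bsdp_g<label>_3_ker`** = Part 24e's `bsdp_g<label>_3_tam` with
the field binders DISCHARGED. What a booking desk still prices per row (displayed): the published facts {hGZ, hKo, hB, hGZK, hmod, hnf,
hMz, hAU, hC2}; Cremona's `r_an = 1` (`hr`) and `#Ш_an = 9` (`hq`/`hv`); the twist datum `L(E^{(d)},1) ≠ 0` (`hLt`) and
`#Ш_an(Wd) = qd`, `ord₃ qd ≤ 0` (`hqd`/`hvd`) — two engines, PARI j293586 + PARI-free j294995; the LB3SUB line `hS`/`hcardS` (`#S = 27`,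
j293463/j293581). Everything else — the three minimal models, additivity and the (G) ∧ ss cell at `3`, `ρ̄₃` onto, `∏ c_ℓ`, the Heegner
field and hypothesis, both twist identities — is decided in the kernel.

References: [GrossLMS1991] §1 (p. 235); [Marcus1977] Ch. 2 Thm. 1, Ch. 3 Thm. 25; [SilvermanAEC2009] VII.5 Prop. 5.1 (a);
[JetchevSkinnerWan2017] §7.4; [McCallumLMS1991] §1; [SchaeferStoll2004]; [Miller2011LMS] Def. 1.1; [Cremona2006] Table 1.
-/

set_option autoImplicit false
set_option linter.dupNamespace false
noncomputable section
open scoped Classical NumberField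
open WeierstrassCurve NumberField IsDedekindDomain Field
  Literature.NumberTheory.DiophantineGeometry Literature.NumberTheory.EllipticCurves
  Literature.NumberTheory.EllipticCurves.ModularForms Literature.NumberTheory.EllipticCurves.Rank1Residual
  Literature.NumberTheory.EllipticCurves.Rank1Residual.Typed Literature.NumberTheory.Automorphic
  Summit.BirchSwinnertonDyer.BirchSwinnertonDyer.Rank1Residual.IntModel
  Summit.BirchSwinnertonDyer.Rank1Residual Summit.BirchSwinnertonDyer.Rank1Residual.Additive
  Summit.BirchSwinnertonDyer.BirchSwinnertonDyer.Theses.AdditiveKolyvaginRoad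
  Summit.BirchSwinnertonDyer.BirchSwinnertonDyer.Theorems.AdditiveKolyvaginKernel
  Summit.BirchSwinnertonDyer.BirchSwinnertonDyer.Theorems

namespace Summit.BirchSwinnertonDyer.BirchSwinnertonDyer.Theorems.AdditiveBranchIMCGordTwoRankOne.HeegnerKolyvagin

/-! ### Bookkeeping: the prime divisors of `Δ` from a complete factorisation -/

/-- **The primes of `Δ` from a kernel-checked complete factorisation**: if `|Δ| = ∏ qᵢ^{eᵢ}` with every `qᵢ` prime and a
property `P` holds at every `qᵢ`, then `P` holds at every prime `q ∣ Δ` (list version of bsd-jet's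
`KolyvaginDepthDoor.forall_prime_dvd_of_natAbs_eq_pow[_mul_pow]`). [folklore] -/
theorem forall_prime_dvd_of_natAbs_eq_prod {Δ : ℤ} (F : List (ℕ × ℕ))
    (h : Δ.natAbs = (F.map fun qe => qe.1 ^ qe.2).prod) (hpr : ∀ qe ∈ F, qe.1.Prime) {P : ℕ → Prop}
    (hP : ∀ qe ∈ F, P qe.1) : ∀ q : ℕ, q.Prime → (q : ℤ) ∣ Δ → P q := by
  intro q hq hqd
  have h1 : q ∣ (F.map fun qe => qe.1 ^ qe.2).prod := h ▸ Int.natCast_dvd.mp hqd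
  obtain ⟨x, hx, hqx⟩ := (Nat.Prime.prime hq).dvd_prod_iff.mp h1
  obtain ⟨qe, hqe, rfl⟩ := List.mem_map.mp hx
  obtain rfl := (Nat.prime_dvd_prime_iff_eq hq (hpr qe hqe)).mp (hq.dvd_of_dvd_pow hqx)
  exact hP qe hqe

/-! ### `182853c1` — Heegner field `ℚ(√-35)`: `d_K = -35` fundamental; primes of `Δ` = `[3, 11, 1847]` all split (`(-35/3) = +1`, `(-35/11) = +1`, `(-35/1847) = +1`) -/

/-- **The Heegner hypothesis for `(N_E, K)`, `E = 182853c1`, for EVERY imaginary quadratic `K` with `d_K = -35`**, IN THE KERNEL: every prime of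
`N_E` divides `Δ_min = Δ(E₀)` (`|Δ| = 3^6·11^1·1847^2` kernel-checked), and at each of them the decomposition law gives a split prime
(`(-35/3) = +1`, `(-35/11) = +1`, `(-35/1847) = +1`; Jacobi symbols by `norm_num`) — bsd-jet's `KolyvaginDepthDoor.satisfiesHeegnerHypothesis_conductorNorm_of_intModel`.
[cite: GrossLMS1991, §1 (p. 235)] [cite: Marcus1977, Ch. 3 Thm. 25] [cite: SilvermanAEC2009, VII.5 Prop. 5.1 (a)] [cite: Cremona2006, Table 1 (Cremona label 182853c1)] -/
theorem heegner_g182853c1 (K : Type) [Field K] [NumberField K] (hK : IsImaginaryQuadratic K) (hdK : NumberField.discr K = -35) :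
    haveI := isElliptic_g182853c1; haveI := isGloballyMinimal_g182853c1
    SatisfiesHeegnerHypothesis ((⟨0, 0, 1, -522, -9187⟩ : WeierstrassCurve ℚ).conductorNorm ℤ) K := by
  haveI := isElliptic_g182853c1
  haveI := isGloballyMinimal_g182853c1
  have hIW : integralModelInt (⟨0, 0, 1, -522, -9187⟩ : WeierstrassCurve ℚ) = (⟨0, 0, 1, -522, -9187⟩ : WeierstrassCurve ℤ) :=
    integralModelInt_eq_of_map_eq _ (map_mk_int 0 0 1 (-522) (-9187))
  refine KolyvaginDepthDoor.satisfiesHeegnerHypothesis_conductorNorm_of_intModel hIW K hK.1 hdK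
    (forall_prime_dvd_of_natAbs_eq_prod [(3, 6), (11, 1), (1847, 2)] (by decide +kernel)
      (by intro qe hqe; simp only [List.mem_cons, List.not_mem_nil, or_false] at hqe
          rcases hqe with rfl | rfl | rfl <;> norm_num)
      (by intro qe hqe; simp only [List.mem_cons, List.not_mem_nil, or_false] at hqe
          rcases hqe with rfl | rfl | rfl <;> norm_num))

/-- **An imaginary quadratic field with `d_K = -35` EXISTS** (`-35` is a negative fundamental discriminant; squarefreeness by `decide`) —
bsd-jet's `KolyvaginDepthDoor.exists_isImaginaryQuadratic_discr_eq` (Marcus Ch. 2 Thm. 1). [cite: Marcus1977, Ch. 2 Thm. 1] [cite: Cremona2006, Table 1 (Cremona label 182853c1)] -/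
theorem exists_field_g182853c1 :
    ∃ (K : Type) (_ : Field K) (_ : NumberField K), IsImaginaryQuadratic K ∧ NumberField.discr K = -35 :=
  KolyvaginDepthDoor.exists_isImaginaryQuadratic_discr_eq (by norm_num)
    (Or.inl ⟨by norm_num, Int.squarefree_natAbs.mp (by decide +kernel), by norm_num⟩)

/-- **`BSD(E,3)` for `E = 182853c1`, Heegner field and Tamagawa binders DISCHARGED** — the GSS2 kernel record in its leanest form: Part 24e's
`bsdp_g182853c1_3_tam` with `K := ` a field of discriminant `-35` (`exists_field_g182853c1`) and the Heegner hypothesis `heegner_g182853c1`.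
DISPLAYED (all that a desk prices): the published facts hGZ hKo hB hGZK hmod hnf (+ cite-only hMz hAU hC2); Cremona's `r_an = 1` (`hr`) and
`#Ш_an = 9` (`hq`/`hv`, `ord₃ ≤ 2`); the twist datum `L(E^{(-35)},1) ≠ 0` (`hLt`) and `#Ш_an(Wd) = qd`, `ord₃ qd ≤ 0` (`hqd`/`hvd`) for the
minimal twist model `Wd = [0, 0, 1, -639450, 393881906]` (two engines: PARI j293586, PARI-free j294995 — `#Ш_an(Wd) = 1`); the LB3SUB certificate line
`S ≤ Sel^(3)(E/ℚ)`, `#S = 27` (`hS`/`hcardS`; j293463/j293581). IN THE KERNEL: everything else (Parts 24a–e: models, minimality, `Addv`,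
(G) ∧ ss, `ρ̄₃` onto, `∏ c_ℓ = 2`, twist identities; here: the field and the Heegner hypothesis). Per pair; nothing booked.
[cite: JetchevSkinnerWan2017, §7.4.1–7.4.3 (pp. 29–31)] [cite: McCallumLMS1991, §1 Theorem (Kolyvagin), p. 296] [cite: GrossLMS1991, §1 (p. 235)]
[cite: SilvermanAEC2009, Thm. X.4.2(a)] [cite: SchaeferStoll2004, §1 and §5] [cite: Miller2011LMS, §1 and Def. 1.1] [cite: Cremona2006, Table 1 (Cremona label 182853c1)] -/
theorem bsdp_g182853c1_3_ker
    (hGZ : ∀ (N : ℕ) [NeZero N] (W : WeierstrassCurve ℚ) (K : Type) [Field K] [NumberField K],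
      gross_zagier N W K)
    (hKo : ∀ (N : ℕ) [NeZero N] (W : WeierstrassCurve ℚ) (K : Type) [Field K] [NumberField K],
      kolyvagin N W K)
    (hB : ∀ (N : ℕ) [NeZero N] (W : WeierstrassCurve ℚ) (K : Type) [Field K] [NumberField K],
      Kolyvagin1990_padicValNat_card_sha_le N W K)
    (hGZK : rank_eq_analyticRank_of_analyticRank_le_one) (hmod : hasEntireLFunction_rat)
    (hnf : exists_isNewformOf) (hMz : mazur_not_dvd_maninConstant_of_odd)
    (hAU : abbesUllmo_not_dvd_maninConstant_of_not_dvd_level)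
    (hC2 : cesnavicius_not_two_dvd_maninConstant_of_two_dvd_level)
    {W : WeierstrassCurve ℚ} [W.IsElliptic] [W.IsGloballyMinimal] (hWeq : W = ⟨0, 0, 1, -522, -9187⟩)
    (hr : W.analyticRank = 1) (hLt : (W.quadraticTwist (-35 : ℚ)).entireLFunction 1 ≠ 0)
    {Wd : WeierstrassCurve ℚ} [Wd.IsElliptic] [Wd.IsGloballyMinimal] (hWdeq : Wd = ⟨0, 0, 1, -639450, 393881906⟩)
    {qd : ℚ} (hqd : shaAn Wd = (qd : ℂ)) (hvd : padicValRat 3 qd ≤ 0)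
    {S : AddSubgroup (W.galH1Torsion (3 : ℤ))} (hS : S ≤ W.selmerGroup (3 : ℤ)) (hcardS : Nat.card S = 27)
    {q : ℚ} (hq : shaAn W = (q : ℂ)) (hv : padicValRat 3 q ≤ 2) : BSDp W 3 := by
  obtain ⟨K, _, _, hK, hdK⟩ := exists_field_g182853c1
  have hHN : SatisfiesHeegnerHypothesis (W.conductorNorm ℤ) K := by subst hWeq; exact heegner_g182853c1 K hK hdK
  exact bsdp_g182853c1_3_tam hGZ hKo hB hGZK hmod hnf hMz hAU hC2 hWeq hr K hK hdK hHN hLt hWdeq hqd hvd hS hcardS hq hv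

/-! ### `228897c1` — Heegner field `ℚ(√-23)`: `d_K = -23` fundamental; primes of `Δ` = `[3, 29, 877]` all split (`(-23/3) = +1`, `(-23/29) = +1`, `(-23/877) = +1`) -/

/-- **The Heegner hypothesis for `(N_E, K)`, `E = 228897c1`, for EVERY imaginary quadratic `K` with `d_K = -23`**, IN THE KERNEL: every prime of
`N_E` divides `Δ_min = Δ(E₀)` (`|Δ| = 3^6·29^4·877^1` kernel-checked), and at each of them the decomposition law gives a split prime
(`(-23/3) = +1`, `(-23/29) = +1`, `(-23/877) = +1`; Jacobi symbols by `norm_num`) — bsd-jet's `KolyvaginDepthDoor.satisfiesHeegnerHypothesis_conductorNorm_of_intModel`.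
[cite: GrossLMS1991, §1 (p. 235)] [cite: Marcus1977, Ch. 3 Thm. 25] [cite: SilvermanAEC2009, VII.5 Prop. 5.1 (a)] [cite: Cremona2006, Table 1 (Cremona label 228897c1)] -/
theorem heegner_g228897c1 (K : Type) [Field K] [NumberField K] (hK : IsImaginaryQuadratic K) (hdK : NumberField.discr K = -23) :
    haveI := isElliptic_g228897c1; haveI := isGloballyMinimal_g228897c1
    SatisfiesHeegnerHypothesis ((⟨0, 0, 1, -32274, -2231422⟩ : WeierstrassCurve ℚ).conductorNorm ℤ) K := by
  haveI := isElliptic_g228897c1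
  haveI := isGloballyMinimal_g228897c1
  have hIW : integralModelInt (⟨0, 0, 1, -32274, -2231422⟩ : WeierstrassCurve ℚ) = (⟨0, 0, 1, -32274, -2231422⟩ : WeierstrassCurve ℤ) :=
    integralModelInt_eq_of_map_eq _ (map_mk_int 0 0 1 (-32274) (-2231422))
  refine KolyvaginDepthDoor.satisfiesHeegnerHypothesis_conductorNorm_of_intModel hIW K hK.1 hdK
    (forall_prime_dvd_of_natAbs_eq_prod [(3, 6), (29, 4), (877, 1)] (by decide +kernel)
      (by intro qe hqe; simp only [List.mem_cons, List.not_mem_nil, or_false] at hqe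
          rcases hqe with rfl | rfl | rfl <;> norm_num)
      (by intro qe hqe; simp only [List.mem_cons, List.not_mem_nil, or_false] at hqe
          rcases hqe with rfl | rfl | rfl <;> norm_num))

/-- **`BSD(E,3)` for `E = 228897c1`, Heegner field and Tamagawa binders DISCHARGED** — the GSS2 kernel record in its leanest form: Part 24e's
`bsdp_g228897c1_3_tam` with `K := ` a field of discriminant `-23` (`KolyvaginDepthDoor.exists_field_neg23`) and the Heegner hypothesis `heegner_g228897c1`.
DISPLAYED (all that a desk prices): the published facts hGZ hKo hB hGZK hmod hnf (+ cite-only hMz hAU hC2); Cremona's `r_an = 1` (`hr`) and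
`#Ш_an = 9` (`hq`/`hv`, `ord₃ ≤ 2`); the twist datum `L(E^{(-23)},1) ≠ 0` (`hLt`) and `#Ш_an(Wd) = qd`, `ord₃ qd ≤ 0` (`hqd`/`hvd`) for the
minimal twist model `Wd = [0, 0, 1, -17072946, 27149708432]` (two engines: PARI j293586, PARI-free j294995 — `#Ш_an(Wd) = 1`); the LB3SUB certificate line
`S ≤ Sel^(3)(E/ℚ)`, `#S = 27` (`hS`/`hcardS`; j293463/j293581). IN THE KERNEL: everything else (Parts 24a–e: models, minimality, `Addv`,
(G) ∧ ss, `ρ̄₃` onto, `∏ c_ℓ = 4`, twist identities; here: the field and the Heegner hypothesis). Per pair; nothing booked.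
[cite: JetchevSkinnerWan2017, §7.4.1–7.4.3 (pp. 29–31)] [cite: McCallumLMS1991, §1 Theorem (Kolyvagin), p. 296] [cite: GrossLMS1991, §1 (p. 235)]
[cite: SilvermanAEC2009, Thm. X.4.2(a)] [cite: SchaeferStoll2004, §1 and §5] [cite: Miller2011LMS, §1 and Def. 1.1] [cite: Cremona2006, Table 1 (Cremona label 228897c1)] -/
theorem bsdp_g228897c1_3_ker
    (hGZ : ∀ (N : ℕ) [NeZero N] (W : WeierstrassCurve ℚ) (K : Type) [Field K] [NumberField K],
      gross_zagier N W K)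
    (hKo : ∀ (N : ℕ) [NeZero N] (W : WeierstrassCurve ℚ) (K : Type) [Field K] [NumberField K],
      kolyvagin N W K)
    (hB : ∀ (N : ℕ) [NeZero N] (W : WeierstrassCurve ℚ) (K : Type) [Field K] [NumberField K],
      Kolyvagin1990_padicValNat_card_sha_le N W K)
    (hGZK : rank_eq_analyticRank_of_analyticRank_le_one) (hmod : hasEntireLFunction_rat)
    (hnf : exists_isNewformOf) (hMz : mazur_not_dvd_maninConstant_of_odd)
    (hAU : abbesUllmo_not_dvd_maninConstant_of_not_dvd_level)
    (hC2 : cesnavicius_not_two_dvd_maninConstant_of_two_dvd_level)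
    {W : WeierstrassCurve ℚ} [W.IsElliptic] [W.IsGloballyMinimal] (hWeq : W = ⟨0, 0, 1, -32274, -2231422⟩)
    (hr : W.analyticRank = 1) (hLt : (W.quadraticTwist (-23 : ℚ)).entireLFunction 1 ≠ 0)
    {Wd : WeierstrassCurve ℚ} [Wd.IsElliptic] [Wd.IsGloballyMinimal] (hWdeq : Wd = ⟨0, 0, 1, -17072946, 27149708432⟩)
    {qd : ℚ} (hqd : shaAn Wd = (qd : ℂ)) (hvd : padicValRat 3 qd ≤ 0)
    {S : AddSubgroup (W.galH1Torsion (3 : ℤ))} (hS : S ≤ W.selmerGroup (3 : ℤ)) (hcardS : Nat.card S = 27)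
    {q : ℚ} (hq : shaAn W = (q : ℂ)) (hv : padicValRat 3 q ≤ 2) : BSDp W 3 := by
  obtain ⟨K, _, _, hK, hdK⟩ := KolyvaginDepthDoor.exists_field_neg23
  have hHN : SatisfiesHeegnerHypothesis (W.conductorNorm ℤ) K := by subst hWeq; exact heegner_g228897c1 K hK hdK
  exact bsdp_g228897c1_3_tam hGZ hKo hB hGZK hmod hnf hMz hAU hC2 hWeq hr K hK hdK hHN hLt hWdeq hqd hvd hS hcardS hq hv

/-! ### `250065g1` — Heegner field `ℚ(√-56)`: `d_K = -56` fundamental; primes of `Δ` = `[3, 5, 5557]` all split (`(-56/3) = +1`, `(-56/5) = +1`, `(-56/5557) = +1`) -/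

/-- **The Heegner hypothesis for `(N_E, K)`, `E = 250065g1`, for EVERY imaginary quadratic `K` with `d_K = -56`**, IN THE KERNEL: every prime of
`N_E` divides `Δ_min = Δ(E₀)` (`|Δ| = 3^6·5^17·5557^1` kernel-checked), and at each of them the decomposition law gives a split prime
(`(-56/3) = +1`, `(-56/5) = +1`, `(-56/5557) = +1`; Jacobi symbols by `norm_num`) — bsd-jet's `KolyvaginDepthDoor.satisfiesHeegnerHypothesis_conductorNorm_of_intModel`.
[cite: GrossLMS1991, §1 (p. 235)] [cite: Marcus1977, Ch. 3 Thm. 25] [cite: SilvermanAEC2009, VII.5 Prop. 5.1 (a)] [cite: Cremona2006, Table 1 (Cremona label 250065g1)] -/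
theorem heegner_g250065g1 (K : Type) [Field K] [NumberField K] (hK : IsImaginaryQuadratic K) (hdK : NumberField.discr K = -56) :
    haveI := isElliptic_g250065g1; haveI := isGloballyMinimal_g250065g1
    SatisfiesHeegnerHypothesis ((⟨1, -1, 0, 310800, 51948125⟩ : WeierstrassCurve ℚ).conductorNorm ℤ) K := by
  haveI := isElliptic_g250065g1
  haveI := isGloballyMinimal_g250065g1
  have hIW : integralModelInt (⟨1, -1, 0, 310800, 51948125⟩ : WeierstrassCurve ℚ) = (⟨1, -1, 0, 310800, 51948125⟩ : WeierstrassCurve ℤ) :=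
    integralModelInt_eq_of_map_eq _ (map_mk_int 1 (-1) 0 310800 51948125)
  refine KolyvaginDepthDoor.satisfiesHeegnerHypothesis_conductorNorm_of_intModel hIW K hK.1 hdK
    (forall_prime_dvd_of_natAbs_eq_prod [(3, 6), (5, 17), (5557, 1)] (by decide +kernel)
      (by intro qe hqe; simp only [List.mem_cons, List.not_mem_nil, or_false] at hqe
          rcases hqe with rfl | rfl | rfl <;> norm_num)
      (by intro qe hqe; simp only [List.mem_cons, List.not_mem_nil, or_false] at hqe
          rcases hqe with rfl | rfl | rfl <;> norm_num))

/-- **An imaginary quadratic field with `d_K = -56` EXISTS** (`-56` is a negative fundamental discriminant; squarefreeness by `decide`) —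
bsd-jet's `KolyvaginDepthDoor.exists_isImaginaryQuadratic_discr_eq` (Marcus Ch. 2 Thm. 1). [cite: Marcus1977, Ch. 2 Thm. 1] [cite: Cremona2006, Table 1 (Cremona label 250065g1)] -/
theorem exists_field_g250065g1 :
    ∃ (K : Type) (_ : Field K) (_ : NumberField K), IsImaginaryQuadratic K ∧ NumberField.discr K = -56 :=
  KolyvaginDepthDoor.exists_isImaginaryQuadratic_discr_eq (by norm_num)
    (Or.inr ⟨by norm_num, by norm_num, Int.squarefree_natAbs.mp (by decide +kernel)⟩)

/-- **`BSD(E,3)` for `E = 250065g1`, Heegner field and Tamagawa binders DISCHARGED** — the GSS2 kernel record in its leanest form: Part 24e's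
`bsdp_g250065g1_3_tam` with `K := ` a field of discriminant `-56` (`exists_field_g250065g1`) and the Heegner hypothesis `heegner_g250065g1`.
DISPLAYED (all that a desk prices): the published facts hGZ hKo hB hGZK hmod hnf (+ cite-only hMz hAU hC2); Cremona's `r_an = 1` (`hr`) and
`#Ш_an = 9` (`hq`/`hv`, `ord₃ ≤ 2`); the twist datum `L(E^{(-56)},1) ≠ 0` (`hLt`) and `#Ш_an(Wd) = qd`, `ord₃ qd ≤ 0` (`hqd`/`hvd`) for the
minimal twist model `Wd = [0, 0, 0, 974668212, -9136567277712]` (two engines: PARI j293586, PARI-free j294995 — `#Ш_an(Wd) = 4`); the LB3SUB certificate line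
`S ≤ Sel^(3)(E/ℚ)`, `#S = 27` (`hS`/`hcardS`; j293463/j293581). IN THE KERNEL: everything else (Parts 24a–e: models, minimality, `Addv`,
(G) ∧ ss, `ρ̄₃` onto, `∏ c_ℓ = 1`, twist identities; here: the field and the Heegner hypothesis). Per pair; nothing booked.
[cite: JetchevSkinnerWan2017, §7.4.1–7.4.3 (pp. 29–31)] [cite: McCallumLMS1991, §1 Theorem (Kolyvagin), p. 296] [cite: GrossLMS1991, §1 (p. 235)]
[cite: SilvermanAEC2009, Thm. X.4.2(a)] [cite: SchaeferStoll2004, §1 and §5] [cite: Miller2011LMS, §1 and Def. 1.1] [cite: Cremona2006, Table 1 (Cremona label 250065g1)] -/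
theorem bsdp_g250065g1_3_ker
    (hGZ : ∀ (N : ℕ) [NeZero N] (W : WeierstrassCurve ℚ) (K : Type) [Field K] [NumberField K],
      gross_zagier N W K)
    (hKo : ∀ (N : ℕ) [NeZero N] (W : WeierstrassCurve ℚ) (K : Type) [Field K] [NumberField K],
      kolyvagin N W K)
    (hB : ∀ (N : ℕ) [NeZero N] (W : WeierstrassCurve ℚ) (K : Type) [Field K] [NumberField K],
      Kolyvagin1990_padicValNat_card_sha_le N W K)
    (hGZK : rank_eq_analyticRank_of_analyticRank_le_one) (hmod : hasEntireLFunction_rat)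
    (hnf : exists_isNewformOf) (hMz : mazur_not_dvd_maninConstant_of_odd)
    (hAU : abbesUllmo_not_dvd_maninConstant_of_not_dvd_level)
    (hC2 : cesnavicius_not_two_dvd_maninConstant_of_two_dvd_level)
    {W : WeierstrassCurve ℚ} [W.IsElliptic] [W.IsGloballyMinimal] (hWeq : W = ⟨1, -1, 0, 310800, 51948125⟩)
    (hr : W.analyticRank = 1) (hLt : (W.quadraticTwist (-56 : ℚ)).entireLFunction 1 ≠ 0)
    {Wd : WeierstrassCurve ℚ} [Wd.IsElliptic] [Wd.IsGloballyMinimal] (hWdeq : Wd = ⟨0, 0, 0, 974668212, -9136567277712⟩)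
    {qd : ℚ} (hqd : shaAn Wd = (qd : ℂ)) (hvd : padicValRat 3 qd ≤ 0)
    {S : AddSubgroup (W.galH1Torsion (3 : ℤ))} (hS : S ≤ W.selmerGroup (3 : ℤ)) (hcardS : Nat.card S = 27)
    {q : ℚ} (hq : shaAn W = (q : ℂ)) (hv : padicValRat 3 q ≤ 2) : BSDp W 3 := by
  obtain ⟨K, _, _, hK, hdK⟩ := exists_field_g250065g1
  have hHN : SatisfiesHeegnerHypothesis (W.conductorNorm ℤ) K := by subst hWeq; exact heegner_g250065g1 K hK hdK
  exact bsdp_g250065g1_3_tam hGZ hKo hB hGZK hmod hnf hMz hAU hC2 hWeq hr K hK hdK hHN hLt hWdeq hqd hvd hS hcardS hq hv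

/-! ### `355338h1` — Heegner field `ℚ(√-71)`: `d_K = -71` fundamental; primes of `Δ` = `[2, 3, 19, 1039]` all split (`-71 ≡ 1 (mod 8)`, `(-71/3) = +1`, `(-71/19) = +1`, `(-71/1039) = +1`) -/

/-- **The Heegner hypothesis for `(N_E, K)`, `E = 355338h1`, for EVERY imaginary quadratic `K` with `d_K = -71`**, IN THE KERNEL: every prime of
`N_E` divides `Δ_min = Δ(E₀)` (`|Δ| = 2^1·3^6·19^1·1039^4` kernel-checked), and at each of them the decomposition law gives a split prime
(`-71 ≡ 1 (mod 8)`, `(-71/3) = +1`, `(-71/19) = +1`, `(-71/1039) = +1`; Jacobi symbols by `norm_num`) — bsd-jet's `KolyvaginDepthDoor.satisfiesHeegnerHypothesis_conductorNorm_of_intModel`.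
[cite: GrossLMS1991, §1 (p. 235)] [cite: Marcus1977, Ch. 3 Thm. 25] [cite: SilvermanAEC2009, VII.5 Prop. 5.1 (a)] [cite: Cremona2006, Table 1 (Cremona label 355338h1)] -/
theorem heegner_g355338h1 (K : Type) [Field K] [NumberField K] (hK : IsImaginaryQuadratic K) (hdK : NumberField.discr K = -71) :
    haveI := isElliptic_g355338h1; haveI := isGloballyMinimal_g355338h1
    SatisfiesHeegnerHypothesis ((⟨1, -1, 0, 22278, 8543762⟩ : WeierstrassCurve ℚ).conductorNorm ℤ) K := by
  haveI := isElliptic_g355338h1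
  haveI := isGloballyMinimal_g355338h1
  have hIW : integralModelInt (⟨1, -1, 0, 22278, 8543762⟩ : WeierstrassCurve ℚ) = (⟨1, -1, 0, 22278, 8543762⟩ : WeierstrassCurve ℤ) :=
    integralModelInt_eq_of_map_eq _ (map_mk_int 1 (-1) 0 22278 8543762)
  refine KolyvaginDepthDoor.satisfiesHeegnerHypothesis_conductorNorm_of_intModel hIW K hK.1 hdK
    (forall_prime_dvd_of_natAbs_eq_prod [(2, 1), (3, 6), (19, 1), (1039, 4)] (by decide +kernel)
      (by intro qe hqe; simp only [List.mem_cons, List.not_mem_nil, or_false] at hqe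
          rcases hqe with rfl | rfl | rfl | rfl <;> norm_num)
      (by intro qe hqe; simp only [List.mem_cons, List.not_mem_nil, or_false] at hqe
          rcases hqe with rfl | rfl | rfl | rfl <;> norm_num))

/-- **An imaginary quadratic field with `d_K = -71` EXISTS** (`-71` is a negative fundamental discriminant; squarefreeness by `decide`) —
bsd-jet's `KolyvaginDepthDoor.exists_isImaginaryQuadratic_discr_eq` (Marcus Ch. 2 Thm. 1). [cite: Marcus1977, Ch. 2 Thm. 1] [cite: Cremona2006, Table 1 (Cremona label 355338h1)] -/
theorem exists_field_g355338h1 :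
    ∃ (K : Type) (_ : Field K) (_ : NumberField K), IsImaginaryQuadratic K ∧ NumberField.discr K = -71 :=
  KolyvaginDepthDoor.exists_isImaginaryQuadratic_discr_eq (by norm_num)
    (Or.inl ⟨by norm_num, Int.squarefree_natAbs.mp (by decide +kernel), by norm_num⟩)

/-- **`BSD(E,3)` for `E = 355338h1`, Heegner field and Tamagawa binders DISCHARGED** — the GSS2 kernel record in its leanest form: Part 24e's
`bsdp_g355338h1_3_tam` with `K := ` a field of discriminant `-71` (`exists_field_g355338h1`) and the Heegner hypothesis `heegner_g355338h1`.
DISPLAYED (all that a desk prices): the published facts hGZ hKo hB hGZK hmod hnf (+ cite-only hMz hAU hC2); Cremona's `r_an = 1` (`hr`) and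
`#Ш_an = 9` (`hq`/`hv`, `ord₃ ≤ 2`); the twist datum `L(E^{(-71)},1) ≠ 0` (`hLt`) and `#Ш_an(Wd) = qd`, `ord₃ qd ≤ 0` (`hqd`/`hvd`) for the
minimal twist model `Wd = [1, -1, 0, 112302453, -3059927850925]` (two engines: PARI j293586, PARI-free j294995 — `#Ш_an(Wd) = 1`); the LB3SUB certificate line
`S ≤ Sel^(3)(E/ℚ)`, `#S = 27` (`hS`/`hcardS`; j293463/j293581). IN THE KERNEL: everything else (Parts 24a–e: models, minimality, `Addv`,
(G) ∧ ss, `ρ̄₃` onto, `∏ c_ℓ = 4`, twist identities; here: the field and the Heegner hypothesis). Per pair; nothing booked.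
[cite: JetchevSkinnerWan2017, §7.4.1–7.4.3 (pp. 29–31)] [cite: McCallumLMS1991, §1 Theorem (Kolyvagin), p. 296] [cite: GrossLMS1991, §1 (p. 235)]
[cite: SilvermanAEC2009, Thm. X.4.2(a)] [cite: SchaeferStoll2004, §1 and §5] [cite: Miller2011LMS, §1 and Def. 1.1] [cite: Cremona2006, Table 1 (Cremona label 355338h1)] -/
theorem bsdp_g355338h1_3_ker
    (hGZ : ∀ (N : ℕ) [NeZero N] (W : WeierstrassCurve ℚ) (K : Type) [Field K] [NumberField K],
      gross_zagier N W K)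
    (hKo : ∀ (N : ℕ) [NeZero N] (W : WeierstrassCurve ℚ) (K : Type) [Field K] [NumberField K],
      kolyvagin N W K)
    (hB : ∀ (N : ℕ) [NeZero N] (W : WeierstrassCurve ℚ) (K : Type) [Field K] [NumberField K],
      Kolyvagin1990_padicValNat_card_sha_le N W K)
    (hGZK : rank_eq_analyticRank_of_analyticRank_le_one) (hmod : hasEntireLFunction_rat)
    (hnf : exists_isNewformOf) (hMz : mazur_not_dvd_maninConstant_of_odd)
    (hAU : abbesUllmo_not_dvd_maninConstant_of_not_dvd_level)
    (hC2 : cesnavicius_not_two_dvd_maninConstant_of_two_dvd_level)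
    {W : WeierstrassCurve ℚ} [W.IsElliptic] [W.IsGloballyMinimal] (hWeq : W = ⟨1, -1, 0, 22278, 8543762⟩)
    (hr : W.analyticRank = 1) (hLt : (W.quadraticTwist (-71 : ℚ)).entireLFunction 1 ≠ 0)
    {Wd : WeierstrassCurve ℚ} [Wd.IsElliptic] [Wd.IsGloballyMinimal] (hWdeq : Wd = ⟨1, -1, 0, 112302453, -3059927850925⟩)
    {qd : ℚ} (hqd : shaAn Wd = (qd : ℂ)) (hvd : padicValRat 3 qd ≤ 0)
    {S : AddSubgroup (W.galH1Torsion (3 : ℤ))} (hS : S ≤ W.selmerGroup (3 : ℤ)) (hcardS : Nat.card S = 27)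
    {q : ℚ} (hq : shaAn W = (q : ℂ)) (hv : padicValRat 3 q ≤ 2) : BSDp W 3 := by
  obtain ⟨K, _, _, hK, hdK⟩ := exists_field_g355338h1
  have hHN : SatisfiesHeegnerHypothesis (W.conductorNorm ℤ) K := by subst hWeq; exact heegner_g355338h1 K hK hdK
  exact bsdp_g355338h1_3_tam hGZ hKo hB hGZK hmod hnf hMz hAU hC2 hWeq hr K hK hdK hHN hLt hWdeq hqd hvd hS hcardS hq hv

end Summit.BirchSwinnertonDyer.BirchSwinnertonDyer.Theorems.AdditiveBranchIMCGordTwoRankOne.HeegnerKolyvagin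

end
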